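import Mathlib
import HarnessLib
import Summits.HubbardSuperconductivity.HubbardSuperconductivity.Theorems.KLProgrammeC4aJacobianPolarJets
import Summits.HubbardSuperconductivity.HubbardSuperconductivity.Theorems.KLProgrammeC4aTubeTadpole
import Summits.HubbardSuperconductivity.HubbardSuperconductivity.Theorems.KLProgrammePerturbedFermiCurveHigherDerivsFrame

/-!
# Route `KLProgramme` — crux C4a, named input (i) «Jacobian jets» AT THE FRAME, orders 0–2 with EXPLICIT constants:
# `‖∂_ϑⁱ levelChartJac μ K (ρ, ·)‖ ≤ klJacG B A A₃ i`, `i ≤ 2`, uniformly on the tube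

Cell `gate-hubbard-kl`, lane hubbard-kl-c4a-1 (g2); helper for the engine-flow child `KLRegimeEngineV17F2` (stmt-HubbardSuperconductivity-20437),
stub (C) `stub_twoLeg_curvature` (memo HOME/hubbard-kl-c4a-1/C4A-PLAN.md §12.2/12.3′; plan g17 KL STATUS l.3124 (1): «Jacobian jets = c4a-1»).
The chart weight of …C4aTubeTadpole at level `ρ` is `levelChartJac μ K (ρ, ϑ) = u·∂_μu` with `u = u_K(μ+ρ; ϑ)`; by `hasDerivAt_perturbedFermiRadius_level`
and `fderiv_pertBand_apply_dir` it is the POLAR JACOBIAN `u / D` of …C4aJacobianPolarJets for the perturbed band `e = ε₀ + δ_K` at level `μ + ρ`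
(`D = ∂_t e` along the ray).  Feeding that file the frame's sizes (`…PerturbedFermiCurveHigherDerivsFrame.frame_band_data`: `‖Dδ_K‖ ≤ 2A`,
`‖D²δ_K‖ ≤ 4A`; `norm_fderiv_three_frameShift_le`: `‖D³δ_K‖ ≤ 8A₃`; hence `E₁ = 4+2A`, `E₂ = 4+4A`, `E₃ = 4+8A₃`; `ρ₀ = Dt_min − 2A`; `U₀ = π√2`;
`R₁ = (4+2A)π√2/(Dt_min−2A)`, `R₂` from `abs_deriv_two_le_of_isRoot`) gives the orders `0, 1, 2` of the Jacobian jets with explicit constants,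
AFFINE in `A₃` at order 2 and free of `A₄, A₅` (those enter at orders 3, 4 only — g3, same pattern with `E₄ = 4+16A₄`, `E₅` by in-piece Bernstein).

* §1 `levelChartJac_eq_polarJac` (pointwise and as functions of the angle);
* §2 `klJacR1`, `klJacR2`, `klJacΔ1`, `klJacΔ2`, `klJacG` (the explicit constants) and the three bounds
  `abs_levelChartJac_le'`, `abs_deriv_levelChartJac_le`, `abs_deriv_two_levelChartJac_le`;
* §3 `norm_iteratedDeriv_levelChartJac_le_two` — the `hJjet` shape of `norm_iteratedDeriv_tubeTadpole_le` for `N = 2`.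

Pure calculus on the tree's objects; nothing is asserted about the Hubbard model.  References: BGM 2006 §2.4 Lemma 2.1 (2.40)
[cite: BenfattoGiulianiMastropietro2006].
-/

noncomputable section

namespace Summit.HubbardSuperconductivity.HubbardSuperconductivity.Theorems.C4a

set_option linter.dupNamespace false -- summit = problem name (single-conjunct summit), D-0017
set_option maxSynthPendingDepth 3 -- nested operator-norm instances (third Fréchet derivatives)

open Real Set
open Literature.MathematicalPhysics.QuantumLattice Literature.MathematicalPhysics.QuantumLattice.BandSectorCounting
open Summit.HubbardSuperconductivity.HubbardSuperconductivity.Theorems.DispersionFlow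
open Summit.HubbardSuperconductivity.HubbardSuperconductivity.Theorems.KLRegimeSplit
open Summit.HubbardSuperconductivity.HubbardSuperconductivity.Theorems.PerturbedFermiCurve

/-! ## §2 (constants first) The explicit tables -/

/-- `R₁(A) = (4+2A)·π√2/(Dt_min − 2A)` — the uniform slope bound of the frame's radius. -/
def klJacR1 (Dt A : ℝ) : ℝ := (4 + 2 * A) * (π * Real.sqrt 2) / (Dt - 2 * A)

/-- `R₂(A)` — the uniform second-derivative bound of the frame's radius (`abs_deriv_two_le_of_isRoot` at `R₁ = klJacR1`). -/
def klJacR2 (Dt A : ℝ) : ℝ :=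
  ((4 + 4 * A) * (klJacR1 Dt A + π * Real.sqrt 2) ^ 2 + (4 + 2 * A) * (2 * klJacR1 Dt A + π * Real.sqrt 2)) / (Dt - 2 * A)

/-- `Δ₁ = E₂(R₁+U₀) + E₁` with `E₁ = 4+2A`, `E₂ = 4+4A`, `U₀ = π√2`. -/
def klJacΔ1 (Dt A : ℝ) : ℝ := (4 + 4 * A) * (klJacR1 Dt A + π * Real.sqrt 2) + (4 + 2 * A)

/-- `Δ₂ = E₃(R₁+U₀)² + E₂(R₂+2R₁+U₀) + 2E₂(R₁+U₀) + E₁` with `E₃ = 4+8A₃`. -/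
def klJacΔ2 (Dt A A₃ : ℝ) : ℝ :=
  (4 + 8 * A₃) * (klJacR1 Dt A + π * Real.sqrt 2) ^ 2 + (4 + 4 * A) * (klJacR2 Dt A + 2 * klJacR1 Dt A + π * Real.sqrt 2) +
    2 * ((4 + 4 * A) * (klJacR1 Dt A + π * Real.sqrt 2)) + (4 + 2 * A)

/-- **The Jacobian-jet table, orders 0–2**: `G₀ = π√2/ρ₀`, `G₁ = R₁/ρ₀ + π√2·Δ₁/ρ₀²`,
`G₂ = R₂/ρ₀ + 2R₁Δ₁/ρ₀² + π√2·Δ₂/ρ₀² + 2π√2·Δ₁²/ρ₀³` (`ρ₀ = Dt_min − 2A`); orders `≥ 3` are not tabled here. -/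
def klJacG (Dt A A₃ : ℝ) (i : ℕ) : ℝ :=
  if i = 0 then π * Real.sqrt 2 / (Dt - 2 * A)
  else if i = 1 then klJacR1 Dt A / (Dt - 2 * A) + π * Real.sqrt 2 * klJacΔ1 Dt A / (Dt - 2 * A) ^ 2
  else klJacR2 Dt A / (Dt - 2 * A) + 2 * (klJacR1 Dt A * klJacΔ1 Dt A) / (Dt - 2 * A) ^ 2 +
    π * Real.sqrt 2 * klJacΔ2 Dt A A₃ / (Dt - 2 * A) ^ 2 + 2 * (π * Real.sqrt 2 * klJacΔ1 Dt A ^ 2) / (Dt - 2 * A) ^ 3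

section Frame

variable {a b : ℝ} (B : BandBounds a b) {K : TrigPolyC4v} {A : ℝ}
  (hA : ∀ p : Momentum, ∀ j ≤ 2, ‖iteratedFDeriv ℝ j (frameShift K) p‖ ≤ A) (hADt : 2 * A < B.Dtmin)
  {μ ρ : ℝ} (hlo : a < μ + ρ - A) (hhi : μ + ρ + A < b)
include B hA hADt hlo hhi

/-! ## §1 The chart weight is the polar Jacobian of the perturbed band at level `μ + ρ` -/

/-- **`levelChartJac μ K (ρ, ϑ) = u ϑ / D(ε₀ + δ_K)(u ϑ • dir ϑ)[dir ϑ]`**, `u = u_K(μ+ρ; ·)`. -/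
theorem levelChartJac_eq_polarJac (ϑ : ℝ) :
    levelChartJac μ K (ρ, ϑ) =
      perturbedFermiRadius (fun k : Fin 2 → ℝ => -K.eval k) (μ + ρ) ϑ /
        fderiv ℝ (fun k : Fin 2 → ℝ => sqDispersion k + (fun k : Fin 2 → ℝ => -K.eval k) k)
          (perturbedFermiRadius (fun k : Fin 2 → ℝ => -K.eval k) (μ + ρ) ϑ • dir ϑ) (dir ϑ) := by
  obtain ⟨hC, hδ, hκ, -, -⟩ := frame_band_data B hA (μ := μ + ρ) hlo.le hhi.le
  have hlev := (hasDerivAt_perturbedFermiRadius_level B hC (by norm_num) hδ hκ hADt (μ₀ := μ + ρ) hlo hhi ϑ).deriv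
  rw [levelChartJac_apply]
  simp only
  rw [hlev, fderiv_pertBand_apply_dir hC ϑ, div_eq_mul_inv]

/-- The same, as functions of the angle. -/
theorem levelChartJac_curve_eq_polarJac :
    (fun ϑ : ℝ => levelChartJac μ K (ρ, ϑ)) = fun ϑ : ℝ =>
      perturbedFermiRadius (fun k : Fin 2 → ℝ => -K.eval k) (μ + ρ) ϑ /
        fderiv ℝ (fun k : Fin 2 → ℝ => sqDispersion k + (fun k : Fin 2 → ℝ => -K.eval k) k)
          (perturbedFermiRadius (fun k : Fin 2 → ℝ => -K.eval k) (μ + ρ) ϑ • dir ϑ) (dir ϑ) :=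
  funext fun ϑ => levelChartJac_eq_polarJac B hA hADt hlo hhi ϑ

/-! ## §2 The three bounds -/

/-- The band data at level `μ + ρ` in the shape …C4aJacobianPolarJets consumes (uniform in the angle). -/
theorem polar_data :
    ContDiff ℝ 4 (fun k : Fin 2 → ℝ => sqDispersion k + (fun k : Fin 2 → ℝ => -K.eval k) k) ∧
    ContDiff ℝ 4 (perturbedFermiRadius (fun k : Fin 2 → ℝ => -K.eval k) (μ + ρ)) ∧
    (∀ ϑ, B.Dtmin - 2 * A ≤ fderiv ℝ (fun k : Fin 2 → ℝ => sqDispersion k + (fun k : Fin 2 → ℝ => -K.eval k) k)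
        (perturbedFermiRadius (fun k : Fin 2 → ℝ => -K.eval k) (μ + ρ) ϑ • dir ϑ) (dir ϑ)) ∧
    (∀ ϑ, ‖fderiv ℝ (fun k : Fin 2 → ℝ => sqDispersion k + (fun k : Fin 2 → ℝ => -K.eval k) k)
        (perturbedFermiRadius (fun k : Fin 2 → ℝ => -K.eval k) (μ + ρ) ϑ • dir ϑ)‖ ≤ 4 + 2 * A) ∧
    (∀ ϑ, ‖fderiv ℝ (fderiv ℝ (fun k : Fin 2 → ℝ => sqDispersion k + (fun k : Fin 2 → ℝ => -K.eval k) k))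
        (perturbedFermiRadius (fun k : Fin 2 → ℝ => -K.eval k) (μ + ρ) ϑ • dir ϑ)‖ ≤ 4 + 4 * A) ∧
    (∀ ϑ, |perturbedFermiRadius (fun k : Fin 2 → ℝ => -K.eval k) (μ + ρ) ϑ| ≤ π * Real.sqrt 2) ∧
    (∀ ϑ, |deriv (perturbedFermiRadius (fun k : Fin 2 → ℝ => -K.eval k) (μ + ρ)) ϑ| ≤ klJacR1 B.Dtmin A) ∧
    (∀ ϑ, |deriv (deriv (perturbedFermiRadius (fun k : Fin 2 → ℝ => -K.eval k) (μ + ρ))) ϑ| ≤ klJacR2 B.Dtmin A) := by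
  obtain ⟨hC, hδ, hκ, hκ₂, hroot⟩ := frame_band_data B hA (μ := μ + ρ) hlo.le hhi.le
  refine ⟨contDiff_pertBand hC, contDiff_four_of_isRoot B hC hδ hlo.le hhi.le hκ hADt hroot,
    fun ϑ => Dtmin_sub_le_fderiv_pertBand_dir B hδ hlo.le hhi.le hκ hroot hC ϑ, fun ϑ => norm_fderiv_pertBand_le hC hκ hroot ϑ,
    fun ϑ => norm_fderiv_two_pertBand_le hC hroot hκ₂ ϑ, fun ϑ => abs_root_le_pi_mul_sqrt_two B hδ hlo.le hhi.le hroot ϑ,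
    fun ϑ => ?_, fun ϑ => ?_⟩
  · exact abs_deriv_le_uniform B hC hδ hlo.le hhi.le hκ hADt hroot ϑ
  · exact abs_deriv_two_le_of_isRoot B hC hδ hlo.le hhi.le hκ hADt hroot hκ₂ (abs_deriv_le_uniform B hC hδ hlo.le hhi.le hκ hADt hroot ϑ)

/-- **Order 0**: `|levelChartJac μ K (ρ, ϑ)| ≤ klJacG B.Dtmin A A₃ 0 = π√2/(Dt_min − 2A)`. -/
theorem abs_levelChartJac_le' (A₃ : ℝ) (ϑ : ℝ) : |levelChartJac μ K (ρ, ϑ)| ≤ klJacG B.Dtmin A A₃ 0 := by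
  obtain ⟨-, -, hρ, -, -, hU₀, -, -⟩ := polar_data B hA hADt hlo hhi
  rw [levelChartJac_eq_polarJac B hA hADt hlo hhi ϑ, klJacG, if_pos rfl]
  exact abs_polarJac_le (sub_pos.2 hADt) (hρ ϑ) (hU₀ ϑ)

/-- **Order 1**: `|∂_ϑ levelChartJac μ K (ρ, ϑ)| ≤ klJacG B.Dtmin A A₃ 1`. -/
theorem abs_deriv_levelChartJac_le (A₃ : ℝ) (ϑ : ℝ) :
    |deriv (fun s : ℝ => levelChartJac μ K (ρ, s)) ϑ| ≤ klJacG B.Dtmin A A₃ 1 := by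
  obtain ⟨he, hu, hρ, hE₁, hE₂, hU₀, hR₁, -⟩ := polar_data B hA hADt hlo hhi
  rw [levelChartJac_curve_eq_polarJac B hA hADt hlo hhi, klJacG, if_neg one_ne_zero, if_pos rfl]
  have h := abs_deriv_polarJac_le he hu (sub_pos.2 hADt) hρ hE₁ hE₂ hU₀ hR₁ ϑ
  simpa [klJacΔ1, mul_div_assoc] using h

/-- **Order 2**: `|∂_ϑ² levelChartJac μ K (ρ, ϑ)| ≤ klJacG B.Dtmin A A₃ 2` — affine in the order-3 size `A₃` of the frame. -/
theorem abs_deriv_two_levelChartJac_le {A₃ : ℝ} (hA₃ : ∀ p : Momentum, ‖iteratedFDeriv ℝ 3 (frameShift K) p‖ ≤ A₃) (ϑ : ℝ) :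
    |deriv (deriv (fun s : ℝ => levelChartJac μ K (ρ, s))) ϑ| ≤ klJacG B.Dtmin A A₃ 2 := by
  obtain ⟨he, hu, hρ, hE₁, hE₂, hU₀, hR₁, hR₂⟩ := polar_data B hA hADt hlo hhi
  obtain ⟨hC, -, -, -, hroot⟩ := frame_band_data B hA (μ := μ + ρ) hlo.le hhi.le
  have hE₃ : ∀ ϑ, ‖fderiv ℝ (fderiv ℝ (fderiv ℝ (fun k : Fin 2 → ℝ => sqDispersion k + (fun k : Fin 2 → ℝ => -K.eval k) k)))
      (perturbedFermiRadius (fun k : Fin 2 → ℝ => -K.eval k) (μ + ρ) ϑ • dir ϑ)‖ ≤ 4 + 8 * A₃ :=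
    fun ϑ => norm_fderiv_three_pertBand_le hC hroot (fun k _ => norm_fderiv_three_frameShift_le hA₃ k) ϑ
  rw [levelChartJac_curve_eq_polarJac B hA hADt hlo hhi, klJacG, if_neg two_ne_zero, if_neg (by norm_num : (2 : ℕ) ≠ 1)]
  have h := abs_deriv_two_polarJac_le he hu (sub_pos.2 hADt) hρ hE₁ hE₂ hE₃ hU₀ hR₁ hR₂ ϑ
  simpa [klJacΔ1, klJacΔ2, mul_div_assoc] using h

/-! ## §3 The `hJjet` shape for `N = 2` -/

/-- **Jacobian jets of orders `≤ 2` on the tube**, in the shape `norm_iteratedDeriv_tubeTadpole_le` consumes (`N = 2`): for every level `ρ` with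
`[μ + ρ − A, μ + ρ + A] ⊂ (a, b)` strictly, `∀ i ≤ 2, ∀ s, ‖iteratedDeriv i (fun s => levelChartJac μ K (ρ, s)) s‖ ≤ klJacG B.Dtmin A A₃ i`. -/
theorem norm_iteratedDeriv_levelChartJac_le_two {A₃ : ℝ} (hA₃ : ∀ p : Momentum, ‖iteratedFDeriv ℝ 3 (frameShift K) p‖ ≤ A₃)
    {i : ℕ} (hi : i ≤ 2) (s : ℝ) : ‖iteratedDeriv i (fun s : ℝ => levelChartJac μ K (ρ, s)) s‖ ≤ klJacG B.Dtmin A A₃ i := by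
  rw [Real.norm_eq_abs]
  interval_cases i
  · simpa using abs_levelChartJac_le' B hA hADt hlo hhi A₃ s
  · simpa using abs_deriv_levelChartJac_le B hA hADt hlo hhi A₃ s
  · rw [iteratedDeriv_succ, iteratedDeriv_one]
    exact abs_deriv_two_levelChartJac_le B hA hADt hlo hhi hA₃ s

end Frame

end Summit.HubbardSuperconductivity.HubbardSuperconductivity.Theorems.C4a
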